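/- Copyright: the b2b-balaban cell (near-miss cell 7), T⁴-continuum fan-out, lineage t4-ne7b-formalise-leaf-06 (NE7b CRUX
TEAM (2) leaf prover 06), gen 33: «THE VOLUME WINDOW», file 2∕2 (supplier-facing forms).  Released under the licence of the surrounding project. -/
import Summits.QuantumFields.BalabanUV.T4Continuum.Support.HistoryBankingVolumeWindow
import Summits.QuantumFields.BalabanUV.T4Continuum.Support.HistoryBankingRoundingTuned
import Summits.QuantumFields.BalabanUV.T4Continuum.Support.HistoryBankingVolumePlug

/-!
# History banking, M5-2 (c) supplier, file 2∕2, the supplier-facing forms: THE VOLUME WINDOW FROM ONE THRESHOLD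
`ℓ_j ≥ ℓ⋆ᵥ` AND FROM THE COUPLINGS `0 < g_j ≤ γ ≤ e^{−ℓ⋆ᵥ∕2}`; THE ONE-CALL FORMS OF M5-2c's CALIBRATION AT PRINT'S LETTER;
THE JUNCTIONS WITH THE PREFIX AND WITH M5-2c (route R-P1 of row NE7b; INTERFACE REQUEST IR-48-2 of RULING R-OWNER-48-1, «THE VOLUME
WINDOW»; re-open object (α))

Summits-side support leaf of the T⁴-continuum cell (rung (B)+1 on a FINITE torus only; NOT infinite volume, NOT the
mass gap, NOT the Clay statement; NOT a proof of the spine estimate NE7b — the cell's OWN estimate, NOT PRINTED, NOT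
PROVED).  [folklore] real arithmetic (real roots `Real.rpow`, logarithms) over the siblings `HistoryBankingVolumeWindow`
(`uvol`, `lamVol`, `jvol`, `structure VolumeWindow`, `structure VolumeDisplays`, `volumeDisplays_sharp`, `huV_uvol`),
`HistoryBankingSharpShares` (`ell`), `HistoryBankingRoundingSupply` (`le_pow_of_rpow_inv_le`, `le_ell_of_coupling`), the OWNER's
`HistoryBankingRoundingTuned` (`forSmallCouplings_inInterval`) and the Literature prefix `T4ContinuumYM4Torus.ForSmallCouplings` ∕
`T4Continuum.FiniteEpsData.Tuned` ∕ `Setup.Flow.InInterval`, and the OWNER's M5-2c `HistoryBankingVolumePlug.credit_mul_volume_le_shapeTH`; no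
`[cite:]` tag, nothing printed asserted, no `def … : Prop`, zero `sorry`.

WHY.  The window `VolumeWindow` of the sibling has four clauses «constant·cΛ ≤ constant·ℓ_j^{gap}» per performed step; the
END's quantifier prefix is `ForSmallCouplings` («every coupling of the run in `]0, γ]`»).  This file closes the gap between
the two shapes exactly as `HistoryBankingRoundingSupply` does for the rounding window: ONE closed-form threshold `ℓ⋆ᵥ` (a
`max` of real roots of the four constant ratios) such that `ℓ⋆ᵥ ≤ ℓ_j` (`j ≤ K`) gives the window, and the coupling form
`0 < g_j ≤ γ ≤ e^{−ℓ⋆ᵥ∕2}` gives `ℓ⋆ᵥ ≤ ℓ_j`; then the one-call forms the (α) assembly's input record and its next twin (SPEC D-48-1 «THE PREFIX TWIN»: ONE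
volume display `hΛ : log (Φf.Λ K t) = uvol cΛ (flow.g) K t` + the prefix's `Flow.InInterval`) consume.

WHAT.  §1 **`ellVol C d κ₂ κᵥ cΛ θᵥ Lu jl`** `= max{1, (6(561^d·jl·Lu + 1122^d·Lu)·cΛ∕E₂)^{1∕κ₂}, (15·126^d·cΛ∕E₂)^{1∕κ₂},
(24·126^d·cΛ∕E₃)^{1∕κ₂}, (2^{d+3}·cΛ∕(θᵥA₀²))^{1∕κᵥ}}`; **`volumeWindow_of_threshold`** (bookkeeping, gaps `κ₂, κᵥ ≥ 1`,
`cΛ ≥ 0`, `E₂, E₃, θᵥ > 0`, `A₀ ≠ 0`, `Lu ≥ 0`, and `ℓ⋆ᵥ ≤ ℓ_j` for `j ≤ K` ⇒ `VolumeWindow`); **`volumeWindow_of_couplings`**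
(`0 < g_j ≤ γ ≤ e^{−ℓ⋆ᵥ∕2}`).  §2 the one-call forms at `Lu := 1 + β₀`, `jl := jvol d (1+β₀)`:
**`volumeDisplays_sharp_of_couplings`** (abstract letter `uvol`), **`volumeDisplays_of_log_eq_of_couplings`** (any pinned
cost `log (Λ t) = uvol cΛ g K t`), **`volumeDisplays_lamVol_of_couplings`** + **`huV_lamVol_of_couplings`** (the cost `lamVol`) —
from (2.7) at any exponent `p ≥ 1`, (2.5) `B14.IsRj`, constants, couplings.  (The two-sided envelope variant `c₁·ℓ ≤ log Λ ≤ cΛ·ℓ`, `Lu := (cΛ∕c₁)(1+β₀)`, is STAGED apart —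
`HOME/t4/…/leaf-06/g33/`, 400-line rule; on event.)  §3 the coupling clause IS the headline's
prefix (the OWNER's `HistoryBankingRoundingTuned` pattern, R-OWNER-48-2 (3) ∕ OI-73): **`volumeDisplays_lamVol_of_inInterval`**,
**`huV_lamVol_of_inInterval`**, the `hΛ`-route forms **`volumeDisplays_of_log_eq_of_inInterval`** ∕
**`huV_events_of_log_eq_of_inInterval`** (SPEC D-48-1's fillers), `exp_neg_ellVol_pos`, **`volumeDisplays_lamVol_of_tuned`**,
**`forSmallCouplings_volumeDisplays`** (outer threshold
`e^{−ℓ⋆ᵥ∕2}`; side letters (2.7) at `p ≥ 1` and (2.5) per cutoff, as `HistoryFlow.flowBinders_of_tuned` supplies them).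
§4 junction with M5-2c BY NAME: **`credit_mul_volume_le_shapeTH_of_volumeDisplays`** (the bundle's fields ARE the OWNER's eight
calibration binders — kernel test, everything else verbatim) and **`credit_mul_volume_le_shapeTH_lamVol`** (M5-2c at `Λ := lamVol`:
calibration AND `huθ` discharged; left: pedigree∕realisation data, `C.a + θᵥ ≤ ½γ₀A₁²`, constants, births at performed steps —
the last one discharged by `births_le_of_step_le` when `Pd.step c ≤ K`: **`credit_mul_volume_le_shapeTH_lamVol_of_step_le`**).

CENSUS NOTE (advisory floats, one engine, UNCERTIFIED; constants stay SYMBOLIC here, trigger c2∕c6): at (d, r, q′, p₀) =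
(4, 2, 5, 23): `κ₂ = r q′ − 1 = 9`, `κᵥ = 2p₀ − 1 = 45`, `jvol 4 (1+β₀) = 64` (`β₀ ∈ [0, 0.8]`); (WV1) binds:
`ℓ⋆ᵥ ≈ 33.1·((1+β₀)cΛ∕E₂)^{1∕9}` ((WV2) `11.6·(cΛ∕E₂)^{1∕9}`, (WV3) `12.2·(cΛ∕E₃)^{1∕9}`, (WV4) `1.11·(cΛ∕(θᵥA₀²))^{1∕45}`) —
below the rounding window's (WR2)@Φ=0 threshold (`t = d+3`: ≈ 68 at m′ = 1, ≈ 150 at m′ ≥ 2) and far below the BINDING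
(S-G) window of record `ℓ_w‴ = 436 … 565` (calc G31.4) — refuter PRICING-NE7b v16 F88∕F89: K-NIL, census-NIL.

HONEST SCOPE.  Real arithmetic over OUR carriers; `VolumeWindow` is a HYPOTHESIS shape (a smallness of OUR letters,
reducible to `g_j ≤ γ ≤ e^{−ℓ⋆ᵥ∕2}`); `cΛ` is a displayed nonnegative real (print's `O(1)`), never a numeral; nothing of H3 ∕
(B) ∕ BetaPertH is discharged; what stays displayed after this file is the VALUE of the per-cube level cost (pinned at
`lamVol`, or displayed by `hΛ`) — H3's identification — and the window.  Nothing of Bałaban's is asserted or contested: «g_j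
sufficiently small» is typed as an explicit window, nothing more.  NE7b NOT PRINTED ∕ NOT PROVED; spine 0∕9; rung (B)+1 on a
FINITE torus — NOT infinite volume, NOT the mass gap, NOT Clay.  HONEST DEPENDENCY (cell): continuum YM on T⁴ ⇐ BetaPertH ∧
nine spine estimates (0/9 proved); BetaPertH ⇐ (D1) ∧ (D4) ∧ CAP+tail; G-an2-4 gates asym, D1 and NE2/3/4.  This file
changes none of it.
-/

open Finset
open Literature.MathematicalPhysics.QuantumFieldTheory.Balaban1983to89
open T4PersistenceDictionary T4PrintedShapeBanking T4Continuum T4ContinuumYM4Torus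
open Summit.QuantumFields.BalabanUV.T4Continuum.HistoryConstants
open Summit.QuantumFields.BalabanUV.T4Continuum.HistoryBankingSharpShares
open Summit.QuantumFields.BalabanUV.T4Continuum.HistoryBankingRoundingSupply
open Summit.QuantumFields.BalabanUV.T4Continuum.HistoryBankingRoundingTuned
open Summit.QuantumFields.BalabanUV.T4Continuum.HistoryBankingVolumeWindow

namespace Summit.QuantumFields.BalabanUV.T4Continuum.HistoryBankingVolumeSupply

noncomputable section

/-! ## §1 ONE threshold `ℓ⋆ᵥ` and the coupling form `g_j ≤ γ ≤ e^{−ℓ⋆ᵥ∕2}` -/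

section Threshold

/-- **THE VOLUME THRESHOLD** `ℓ⋆ᵥ = max{1, (6(561^d·jl·Lu + 1122^d·Lu)·cΛ∕E₂)^{1∕κ₂}, (15·126^d·cΛ∕E₂)^{1∕κ₂},
(24·126^d·cΛ∕E₃)^{1∕κ₂}, (2^{d+3}·cΛ∕(θᵥA₀²))^{1∕κᵥ}}` (real roots; a closed-form function of the constants and of the
calibration the clauses are read at). [folklore] -/
def ellVol (C : T4PrintedShapeBanking.Consts) (d κ₂ κᵥ : ℕ) (cΛ θv Lu : ℝ) (jl : ℕ) : ℝ :=
  max 1 (max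
    (max ((6 * (561 ^ d * jl * Lu + 1122 ^ d * Lu) * cΛ / C.E₂) ^ ((1 : ℝ) / κ₂))
      ((15 * 126 ^ d * cΛ / C.E₂) ^ ((1 : ℝ) / κ₂)))
    (max ((24 * 126 ^ d * cΛ / C.E₃) ^ ((1 : ℝ) / κ₂))
      ((2 ^ (d + 3) * cΛ / (θv * C.A₀ ^ 2)) ^ ((1 : ℝ) / κᵥ))))

variable {C : T4PrintedShapeBanking.Consts} {d K r κ₂ κᵥ jl : ℕ} {cΛ θv Lu : ℝ} {g : ℕ → ℝ}

/-- **THE WINDOW FROM ONE THRESHOLD**: with the exponent bookkeeping, gaps `κ₂, κᵥ ≥ 1`, `cΛ ≥ 0`, `E₂ > 0`, `E₃ > 0`,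
`θᵥ > 0`, `A₀ ≠ 0`, `Lu ≥ 0`: if `ℓ⋆ᵥ ≤ ℓ_j` for every `j ≤ K` then `VolumeWindow C d K r κ₂ κᵥ cΛ θᵥ Lu jl g`. [folklore] -/
theorem volumeWindow_of_threshold (hexpF : 1 + κ₂ = r * C.q') (hexpV : 1 + κᵥ = 2 * C.p₀) (hκ₂ : 1 ≤ κ₂)
    (hκᵥ : 1 ≤ κᵥ) (hc : 0 ≤ cΛ) (hE₂ : 0 < C.E₂) (hE₃ : 0 < C.E₃) (hθ : 0 < θv) (hA₀ : C.A₀ ≠ 0) (hLu : 0 ≤ Lu)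
    (hwin : ∀ j, j ≤ K → ellVol C d κ₂ κᵥ cΛ θv Lu jl ≤ ell g j) :
    VolumeWindow C d K r κ₂ κᵥ cΛ θv Lu jl g := by
  have hA2 : 0 < θv * C.A₀ ^ 2 := by positivity
  have hΦ0 : 0 ≤ 6 * (561 ^ d * jl * Lu + 1122 ^ d * Lu) * cΛ := by positivity
  -- unpack the five members of the max at a step `j ≤ K`
  have hle : ∀ j, j ≤ K →
      1 ≤ ell g j ∧
      (6 * (561 ^ d * jl * Lu + 1122 ^ d * Lu) * cΛ / C.E₂) ^ ((1 : ℝ) / κ₂) ≤ ell g j ∧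
      (15 * 126 ^ d * cΛ / C.E₂) ^ ((1 : ℝ) / κ₂) ≤ ell g j ∧
      (24 * 126 ^ d * cΛ / C.E₃) ^ ((1 : ℝ) / κ₂) ≤ ell g j ∧
      (2 ^ (d + 3) * cΛ / (θv * C.A₀ ^ 2)) ^ ((1 : ℝ) / κᵥ) ≤ ell g j := by
    intro j hj
    have h := hwin j hj
    unfold ellVol at h
    simp only [max_le_iff] at h
    exact ⟨h.1, h.2.1.1, h.2.1.2, h.2.2.1, h.2.2.2⟩
  refine ⟨hexpF, hexpV, fun j hj => (hle j hj).1, fun j hj => ?_, fun j hj => ?_, fun j hj => ?_, fun j hj => ?_⟩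
  · have h := le_pow_of_rpow_inv_le (div_nonneg hΦ0 hE₂.le) hκ₂ (hle j hj).2.1
    rw [div_le_iff₀ hE₂] at h
    linarith
  · have h := le_pow_of_rpow_inv_le (by positivity) hκ₂ (hle j hj).2.2.1
    rw [div_le_iff₀ hE₂] at h
    linarith
  · have h := le_pow_of_rpow_inv_le (by positivity) hκ₂ (hle j hj).2.2.2.1
    rw [div_le_iff₀ hE₃] at h
    linarith
  · have h := le_pow_of_rpow_inv_le (by positivity) hκᵥ (hle j hj).2.2.2.2
    rw [div_le_iff₀ hA2] at h
    linarith

/-- **THE WINDOW FROM THE COUPLINGS** (the `ForSmallCouplings`-facing form): if every coupling of the performed range is in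
`]0, γ]` with `γ ≤ e^{−ℓ⋆ᵥ∕2}`, the window holds (same side conditions as `volumeWindow_of_threshold`). [folklore] -/
theorem volumeWindow_of_couplings {γ : ℝ} (hexpF : 1 + κ₂ = r * C.q') (hexpV : 1 + κᵥ = 2 * C.p₀) (hκ₂ : 1 ≤ κ₂)
    (hκᵥ : 1 ≤ κᵥ) (hc : 0 ≤ cΛ) (hE₂ : 0 < C.E₂) (hE₃ : 0 < C.E₃) (hθ : 0 < θv) (hA₀ : C.A₀ ≠ 0) (hLu : 0 ≤ Lu)
    (hγ : γ ≤ Real.exp (-(ellVol C d κ₂ κᵥ cΛ θv Lu jl / 2))) (hg : ∀ j, j ≤ K → 0 < g j ∧ g j ≤ γ) :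
    VolumeWindow C d K r κ₂ κᵥ cΛ θv Lu jl g :=
  volumeWindow_of_threshold hexpF hexpV hκ₂ hκᵥ hc hE₂ hE₃ hθ hA₀ hLu
    fun j hj => le_ell_of_coupling (hg j hj).1 (hg j hj).2 hγ

end Threshold

/-! ## §2 The one-call forms of M5-2c's calibration at print's letter (`Lu := 1 + β₀`, `jl := jvol d (1+β₀)`) -/

section OneCall

variable {C : T4PrintedShapeBanking.Consts} {d K r κ₂ κᵥ p L : ℕ} {cΛ θv β' β₀ γ : ℝ} {g : ℕ → ℝ} {R : ℕ → ℕ}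

/-- **THE CALIBRATION AT THE LETTER `uvol` FROM THE COUPLINGS AND (2.5)** (the END-facing one-call form): exponent bookkeeping,
gaps `≥ 1`, `cΛ ≥ 0`, `E₂, E₃, θᵥ > 0`, `A₀ ≠ 0`, `β₀ ≥ 0`, (2.7) at any exponent `p ≥ 1`, (2.5) `B14.IsRj L r (g_t) (R_t)`
(`t ≤ K`), every coupling `0 < g_j ≤ γ ≤ e^{−ℓ⋆ᵥ∕2}` (`j ≤ K`, `ℓ⋆ᵥ` read at `Lu := 1+β₀`, `jl := jvol d (1+β₀)`) ⇒
`VolumeDisplays C d K R (uvol cΛ g K) (1 + β₀) (jvol d (1 + β₀))`. [folklore] -/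
theorem volumeDisplays_sharp_of_couplings (hexpF : 1 + κ₂ = r * C.q') (hexpV : 1 + κᵥ = 2 * C.p₀) (hκ₂ : 1 ≤ κ₂)
    (hκᵥ : 1 ≤ κᵥ) (hc : 0 ≤ cΛ) (hE₂ : 0 < C.E₂) (hE₃ : 0 < C.E₃) (hθ : 0 < θv) (hA₀ : C.A₀ ≠ 0) (hβ₀ : 0 ≤ β₀)
    (hp : 1 ≤ p) (h27 : B14.FlowIneq27 g β' β₀ p K) (hRj : ∀ t, t ≤ K → B14.IsRj L r (g t) (R t))
    (hγ : γ ≤ Real.exp (-(ellVol C d κ₂ κᵥ cΛ θv (1 + β₀) (jvol d (1 + β₀)) / 2)))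
    (hg : ∀ j, j ≤ K → 0 < g j ∧ g j ≤ γ) :
    VolumeDisplays C d K R (uvol cΛ g K) (1 + β₀) (jvol d (1 + β₀)) :=
  volumeDisplays_sharp_of_isRj hp h27 hβ₀ hc hE₂.le hE₃.le hRj
    (volumeWindow_of_couplings hexpF hexpV hκ₂ hκᵥ hc hE₂ hE₃ hθ hA₀ (by linarith) hγ hg)

/-- **THE RECORD's SEVEN FIELDS FOR ANY COST PINNED AT THE LETTER, FROM THE COUPLINGS AND (2.5)**: for `Λ : ℕ → ℝ` with
`log (Λ t) = uvol cΛ g K t`, `VolumeDisplays C d K R (fun t => log (Λ t)) (1 + β₀) (jvol d (1 + β₀))`. [folklore] -/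
theorem volumeDisplays_of_log_eq_of_couplings {Λ : ℕ → ℝ} (hΛ : ∀ t, Real.log (Λ t) = uvol cΛ g K t)
    (hexpF : 1 + κ₂ = r * C.q') (hexpV : 1 + κᵥ = 2 * C.p₀) (hκ₂ : 1 ≤ κ₂) (hκᵥ : 1 ≤ κᵥ) (hc : 0 ≤ cΛ)
    (hE₂ : 0 < C.E₂) (hE₃ : 0 < C.E₃) (hθ : 0 < θv) (hA₀ : C.A₀ ≠ 0) (hβ₀ : 0 ≤ β₀) (hp : 1 ≤ p)
    (h27 : B14.FlowIneq27 g β' β₀ p K) (hRj : ∀ t, t ≤ K → B14.IsRj L r (g t) (R t))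
    (hγ : γ ≤ Real.exp (-(ellVol C d κ₂ κᵥ cΛ θv (1 + β₀) (jvol d (1 + β₀)) / 2)))
    (hg : ∀ j, j ≤ K → 0 < g j ∧ g j ≤ γ) :
    VolumeDisplays C d K R (fun t => Real.log (Λ t)) (1 + β₀) (jvol d (1 + β₀)) := by
  have h : (fun t => Real.log (Λ t)) = uvol cΛ g K := funext hΛ
  rw [h]
  exact volumeDisplays_sharp_of_couplings hexpF hexpV hκ₂ hκᵥ hc hE₂ hE₃ hθ hA₀ hβ₀ hp h27 hRj hγ hg

/-- **THE RECORD's SEVEN FIELDS AT THE PINNED COST `lamVol`, FROM THE COUPLINGS AND (2.5)** (one call). [folklore] -/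
theorem volumeDisplays_lamVol_of_couplings (hexpF : 1 + κ₂ = r * C.q') (hexpV : 1 + κᵥ = 2 * C.p₀) (hκ₂ : 1 ≤ κ₂)
    (hκᵥ : 1 ≤ κᵥ) (hc : 0 ≤ cΛ) (hE₂ : 0 < C.E₂) (hE₃ : 0 < C.E₃) (hθ : 0 < θv) (hA₀ : C.A₀ ≠ 0) (hβ₀ : 0 ≤ β₀)
    (hp : 1 ≤ p) (h27 : B14.FlowIneq27 g β' β₀ p K) (hRj : ∀ t, t ≤ K → B14.IsRj L r (g t) (R t))
    (hγ : γ ≤ Real.exp (-(ellVol C d κ₂ κᵥ cΛ θv (1 + β₀) (jvol d (1 + β₀)) / 2)))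
    (hg : ∀ j, j ≤ K → 0 < g j ∧ g j ≤ γ) :
    VolumeDisplays C d K R (fun t => Real.log (lamVol cΛ g K t)) (1 + β₀) (jvol d (1 + β₀)) :=
  volumeDisplays_of_log_eq_of_couplings (log_lamVol cΛ g K) hexpF hexpV hκ₂ hκᵥ hc hE₂ hE₃ hθ hA₀ hβ₀ hp h27 hRj hγ hg

/-- **`huV` AT THE PINNED COST `lamVol`, FROM THE COUPLINGS**, per performed step `j ≤ K` (any calibration `Lu ≥ 0`, `jl` the
threshold is read at). [folklore] -/
theorem huV_lamVol_of_couplings {Lu : ℝ} {jl : ℕ} (hexpF : 1 + κ₂ = r * C.q') (hexpV : 1 + κᵥ = 2 * C.p₀)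
    (hκ₂ : 1 ≤ κ₂) (hκᵥ : 1 ≤ κᵥ) (hc : 0 ≤ cΛ) (hE₂ : 0 < C.E₂) (hE₃ : 0 < C.E₃) (hθ : 0 < θv) (hA₀ : C.A₀ ≠ 0)
    (hLu : 0 ≤ Lu) (hγ : γ ≤ Real.exp (-(ellVol C d κ₂ κᵥ cΛ θv Lu jl / 2))) (hg : ∀ j, j ≤ K → 0 < g j ∧ g j ≤ γ)
    (j : ℕ) (hj : j ≤ K) : 2 ^ (d + 3) * Real.log (lamVol cΛ g K j) ≤ θv * p0Profile C.A₀ C.p₀ (g j) ^ 2 :=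
  huV_lamVol (volumeWindow_of_couplings hexpF hexpV hκ₂ hκᵥ hc hE₂ hE₃ hθ hA₀ hLu hγ hg) j hj

end OneCall

/-! ## §3 The window's coupling clause is the headline's own quantifier prefix (the pattern of the OWNER's
`HistoryBankingRoundingTuned`, R-OWNER-48-2 (3) ∕ referee OI-73) -/

section Prefix

variable {C : T4PrintedShapeBanking.Consts} {d K r κ₂ κᵥ p L : ℕ} {cΛ θv β' β₀ γ : ℝ} {R : ℕ → ℕ}

/-- **THE RECORD's SEVEN FIELDS AT `lamVol` FROM `Flow.InInterval`**: `volumeDisplays_lamVol_of_couplings` with its coupling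
hypothesis `∀ j ≤ K, 0 < g_j ∧ g_j ≤ γ` supplied by `Fl.InInterval γ K` — the SAME clause by `Setup.Flow.InInterval`'s
definition. [folklore] -/
theorem volumeDisplays_lamVol_of_inInterval (Fl : Flow) (hI : Fl.InInterval γ K) (hexpF : 1 + κ₂ = r * C.q')
    (hexpV : 1 + κᵥ = 2 * C.p₀) (hκ₂ : 1 ≤ κ₂) (hκᵥ : 1 ≤ κᵥ) (hc : 0 ≤ cΛ) (hE₂ : 0 < C.E₂) (hE₃ : 0 < C.E₃)
    (hθ : 0 < θv) (hA₀ : C.A₀ ≠ 0) (hβ₀ : 0 ≤ β₀) (hp : 1 ≤ p) (h27 : B14.FlowIneq27 Fl.g β' β₀ p K)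
    (hRj : ∀ t, t ≤ K → B14.IsRj L r (Fl.g t) (R t))
    (hγ : γ ≤ Real.exp (-(ellVol C d κ₂ κᵥ cΛ θv (1 + β₀) (jvol d (1 + β₀)) / 2))) :
    VolumeDisplays C d K R (fun t => Real.log (lamVol cΛ Fl.g K t)) (1 + β₀) (jvol d (1 + β₀)) :=
  volumeDisplays_lamVol_of_couplings hexpF hexpV hκ₂ hκᵥ hc hE₂ hE₃ hθ hA₀ hβ₀ hp h27 hRj hγ fun j hj => hI j hj

/-- **`huV` AT `lamVol` FROM `Flow.InInterval`**, per performed step (threshold read at `Lu := 1+β₀`, `jl := jvol d (1+β₀)`).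
[folklore] -/
theorem huV_lamVol_of_inInterval (Fl : Flow) (hI : Fl.InInterval γ K) (hexpF : 1 + κ₂ = r * C.q')
    (hexpV : 1 + κᵥ = 2 * C.p₀) (hκ₂ : 1 ≤ κ₂) (hκᵥ : 1 ≤ κᵥ) (hc : 0 ≤ cΛ) (hE₂ : 0 < C.E₂) (hE₃ : 0 < C.E₃)
    (hθ : 0 < θv) (hA₀ : C.A₀ ≠ 0) (hβ₀ : 0 ≤ β₀)
    (hγ : γ ≤ Real.exp (-(ellVol C d κ₂ κᵥ cΛ θv (1 + β₀) (jvol d (1 + β₀)) / 2))) (j : ℕ) (hj : j ≤ K) :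
    2 ^ (d + 3) * Real.log (lamVol cΛ Fl.g K j) ≤ θv * p0Profile C.A₀ C.p₀ (Fl.g j) ^ 2 :=
  huV_lamVol_of_couplings hexpF hexpV hκ₂ hκᵥ hc hE₂ hE₃ hθ hA₀ (by linarith) hγ (fun j hj => hI j hj) j hj

/-- **THE RECORD's SEVEN FIELDS FOR ANY COST PINNED BY THE DISPLAY `hΛ`, FROM `Flow.InInterval`** (the form SPEC D-48-1
«THE PREFIX TWIN» consumes: `hΛ : ∀ t, log (Λ t) = uvol cΛ g K t` is the twin's ONE volume display, `hI` the prefix's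
interval clause at the volume threshold). [folklore] -/
theorem volumeDisplays_of_log_eq_of_inInterval (Fl : Flow) (hI : Fl.InInterval γ K) {Λ : ℕ → ℝ}
    (hΛ : ∀ t, Real.log (Λ t) = uvol cΛ Fl.g K t) (hexpF : 1 + κ₂ = r * C.q') (hexpV : 1 + κᵥ = 2 * C.p₀)
    (hκ₂ : 1 ≤ κ₂) (hκᵥ : 1 ≤ κᵥ) (hc : 0 ≤ cΛ) (hE₂ : 0 < C.E₂) (hE₃ : 0 < C.E₃) (hθ : 0 < θv) (hA₀ : C.A₀ ≠ 0)
    (hβ₀ : 0 ≤ β₀) (hp : 1 ≤ p) (h27 : B14.FlowIneq27 Fl.g β' β₀ p K) (hRj : ∀ t, t ≤ K → B14.IsRj L r (Fl.g t) (R t))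
    (hγ : γ ≤ Real.exp (-(ellVol C d κ₂ κᵥ cΛ θv (1 + β₀) (jvol d (1 + β₀)) / 2))) :
    VolumeDisplays C d K R (fun t => Real.log (Λ t)) (1 + β₀) (jvol d (1 + β₀)) :=
  volumeDisplays_of_log_eq_of_couplings hΛ hexpF hexpV hκ₂ hκᵥ hc hE₂ hE₃ hθ hA₀ hβ₀ hp h27 hRj hγ fun j hj => hI j hj

/-- **`huV` OVER A MEMBER's KIND-`0` EVENTS FOR A COST PINNED BY `hΛ`, FROM `Flow.InInterval`** (SPEC D-48-1's `huV` filler: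
births at performed steps `hsteps`). [folklore] -/
theorem huV_events_of_log_eq_of_inInterval (Fl : Flow) (hI : Fl.InInterval γ K) {Λ : ℕ → ℝ}
    (hΛ : ∀ t, Real.log (Λ t) = uvol cΛ Fl.g K t) (hexpF : 1 + κ₂ = r * C.q') (hexpV : 1 + κᵥ = 2 * C.p₀)
    (hκ₂ : 1 ≤ κ₂) (hκᵥ : 1 ≤ κᵥ) (hc : 0 ≤ cΛ) (hE₂ : 0 < C.E₂) (hE₃ : 0 < C.E₃) (hθ : 0 < θv) (hA₀ : C.A₀ ≠ 0)
    (hβ₀ : 0 ≤ β₀) (hγ : γ ≤ Real.exp (-(ellVol C d κ₂ κᵥ cΛ θv (1 + β₀) (jvol d (1 + β₀)) / 2))) {ε : Type*}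
    (sh : ε → PEv) (E : Finset ε) (hsteps : ∀ e ∈ E, (sh e).kind = 0 → (sh e).step ≤ K) :
    ∀ e ∈ E, (sh e).kind = 0 →
      2 ^ (d + 3) * Real.log (Λ (sh e).step) ≤ θv * p0Profile C.A₀ C.p₀ (Fl.g (sh e).step) ^ 2 :=
  huV_events_of_log_eq hΛ (volumeWindow_of_couplings hexpF hexpV hκ₂ hκᵥ hc hE₂ hE₃ hθ hA₀ (by linarith) hγ
    fun j hj => hI j hj) sh E hsteps

/-- the volume threshold's coupling bound is positive (the `ForSmallCouplings` outer threshold SPEC D-48-1 takes the `min` with). [folklore] -/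
theorem exp_neg_ellVol_pos (C : T4PrintedShapeBanking.Consts) (d κ₂ κᵥ : ℕ) (cΛ θv Lu : ℝ) (jl : ℕ) :
    0 < Real.exp (-(ellVol C d κ₂ κᵥ cΛ θv Lu jl / 2)) := Real.exp_pos _

variable {F : T4Family} {G : Type*} [GaugeGroup G] [MeasurableSpace G] [HaarData G]

/-- **… FOR THE CUTOFF-`K` RUN OF A DATUM AT A TUNED SEQUENCE** (the letters of `HistReadData`: `g := (D.C ⟨K, F.m, g₀ K⟩).flow.g`):
`D.Tuned γ g g₀` gives `InInterval γ K` for every `K`. [folklore] -/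
theorem volumeDisplays_lamVol_of_tuned (D : FiniteEpsData F G) {g : ℝ} {g₀ : ℕ → ℝ} (ht : D.Tuned γ g g₀) (K : ℕ)
    (hexpF : 1 + κ₂ = r * C.q') (hexpV : 1 + κᵥ = 2 * C.p₀) (hκ₂ : 1 ≤ κ₂) (hκᵥ : 1 ≤ κᵥ) (hc : 0 ≤ cΛ)
    (hE₂ : 0 < C.E₂) (hE₃ : 0 < C.E₃) (hθ : 0 < θv) (hA₀ : C.A₀ ≠ 0) (hβ₀ : 0 ≤ β₀) (hp : 1 ≤ p)
    (h27 : B14.FlowIneq27 (D.C ⟨K, F.m, g₀ K⟩).flow.g β' β₀ p K)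
    (hRj : ∀ t, t ≤ K → B14.IsRj L r ((D.C ⟨K, F.m, g₀ K⟩).flow.g t) (R t))
    (hγ : γ ≤ Real.exp (-(ellVol C d κ₂ κᵥ cΛ θv (1 + β₀) (jvol d (1 + β₀)) / 2))) :
    VolumeDisplays C d K R (fun t => Real.log (lamVol cΛ (D.C ⟨K, F.m, g₀ K⟩).flow.g K t)) (1 + β₀)
      (jvol d (1 + β₀)) :=
  volumeDisplays_lamVol_of_inInterval (D.C ⟨K, F.m, g₀ K⟩).flow (ht K).1 hexpF hexpV hκ₂ hκᵥ hc hE₂ hE₃ hθ hA₀ hβ₀ hp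
    h27 hRj hγ

/-- **THE VOLUME CALIBRATION UNDER THE HEADLINE's OWN PREFIX**: with the outer threshold taken at `e^{−ℓ⋆ᵥ∕2}` (`ellVol` is
`K`-free), for all small-coupling tuned runs and every cutoff `K` whose side letters are supplied ((2.7) at an exponent
`p ≥ 1` and (2.5) on the sizes `R K` — NE7's flow rows, as `HistoryFlow.flowBinders_of_tuned` supplies them), the seven
record fields at `Λ := lamVol` AND `huV` at every performed step hold.  No monotonicity of the flow is used. [folklore] -/
theorem forSmallCouplings_volumeDisplays (D : FiniteEpsData F G) {C : T4PrintedShapeBanking.Consts} {d r κ₂ κᵥ p : ℕ}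
    {cΛ θv β' β₀ : ℝ} (R : ℕ → ℕ → ℕ) (hexpF : 1 + κ₂ = r * C.q') (hexpV : 1 + κᵥ = 2 * C.p₀) (hκ₂ : 1 ≤ κ₂)
    (hκᵥ : 1 ≤ κᵥ) (hc : 0 ≤ cΛ) (hE₂ : 0 < C.E₂) (hE₃ : 0 < C.E₃) (hθ : 0 < θv) (hA₀ : C.A₀ ≠ 0) (hβ₀ : 0 ≤ β₀)
    (hp : 1 ≤ p) :
    ForSmallCouplings D (fun g₀ => ∀ K,
      B14.FlowIneq27 (D.C ⟨K, F.m, g₀ K⟩).flow.g β' β₀ p K →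
      (∀ t, t ≤ K → B14.IsRj F.L r ((D.C ⟨K, F.m, g₀ K⟩).flow.g t) (R K t)) →
      VolumeDisplays C d K (R K) (fun t => Real.log (lamVol cΛ (D.C ⟨K, F.m, g₀ K⟩).flow.g K t)) (1 + β₀)
          (jvol d (1 + β₀)) ∧
        ∀ j, j ≤ K → 2 ^ (d + 3) * Real.log (lamVol cΛ (D.C ⟨K, F.m, g₀ K⟩).flow.g K j) ≤
          θv * p0Profile C.A₀ C.p₀ ((D.C ⟨K, F.m, g₀ K⟩).flow.g j) ^ 2) := by
  refine (forSmallCouplings_inInterval D (Real.exp_pos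
    (-(ellVol C d κ₂ κᵥ cΛ θv (1 + β₀) (jvol d (1 + β₀)) / 2)))).mono fun g₀ hI K h27 hRj => ⟨?_, ?_⟩
  · exact volumeDisplays_lamVol_of_inInterval (D.C ⟨K, F.m, g₀ K⟩).flow (hI K) hexpF hexpV hκ₂ hκᵥ hc hE₂ hE₃ hθ hA₀
      hβ₀ hp h27 hRj le_rfl
  · exact huV_lamVol_of_inInterval (D.C ⟨K, F.m, g₀ K⟩).flow (hI K) hexpF hexpV hκ₂ hκᵥ hc hE₂ hE₃ hθ hA₀ hβ₀ le_rfl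

end Prefix

/-! ## §4 Junction with M5-2c BY NAME: the bundle IS `credit_mul_volume_le_shapeTH`'s calibration binder list -/

section Junction

open Literature.MathematicalPhysics.QuantumFieldTheory.Balaban1983to89.B13ScaleTransfer
open Literature.MathematicalPhysics.QuantumFieldTheory.Balaban1983to89.B16SProfile
open T4TaggedShapeBanking T4BankedInduction T4PartnerMultiplicity
open Summit.QuantumFields.BalabanUV.T4Continuum.LateMergers
open Summit.QuantumFields.BalabanUV.T4Continuum.HistoryAdmissible
open Summit.QuantumFields.BalabanUV.T4Continuum.HistoryRealise
open Summit.QuantumFields.BalabanUV.T4Continuum.HistoryRealiseWeak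
open Summit.QuantumFields.BalabanUV.T4Continuum.HistoryGen
open Summit.QuantumFields.BalabanUV.T4Continuum.HistoryBankingPedigreeLedger
open Summit.QuantumFields.BalabanUV.T4Continuum.HistoryBankingVolumePlug

variable {d L : ℕ} {s R : ℕ → ℕ} {C : T4PrintedShapeBanking.Consts} {α π : Type*} [DecidableEq α] [DecidableEq π]

/-- **M5-2c's `credit_mul_volume_le_shapeTH` FROM THE BUNDLE** (kernel junction test, BY NAME): the eight calibration binders of
the OWNER's theorem are the fields of `VolumeDisplays C d K R u Lu jl` — every other hypothesis and the conclusion VERBATIM.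
[folklore] -/
theorem credit_mul_volume_le_shapeTH_of_volumeDisplays {O : PrintedO1s} {θv : ℝ}
    (hslack : C.a + θv ≤ O.γ₀ * O.A₁ ^ 2 / 2) {Δ Λ' : ℝ} (hΔ : 0 ≤ Δ) (hΛ : 0 ≤ Λ') (g : ℕ → ℝ) (hL : 4 ≤ L)
    (hdrop : ∀ m, DropCtl s m) (hR : ∀ t, 1 ≤ R t) (hn₁ : 13 ≤ C.n₁) (hE₂ : 0 ≤ C.E₂) (hE₃ : 0 ≤ C.E₃)
    (Pd : Pedigree α π) (cell : π → Pt d × Finset (Pt d))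
    (hS : ∀ c c', Part.old c' true ∈ Pd.parts c → Pd.step c' + 1 = Pd.step c) (c : α) {Z : Finset (Pt d)}
    (hP : RealisesW L s R (Pd.toPGen cell c) Z) (hW : (Pd.genT c).WF (dictWT Prod.fst R C.n₁)) {K : ℕ}
    (hPK : (Pd.toPGen cell c).lastStep ≤ K) (hK : K < (Pd.genT c).reach (dictWT Prod.fst R C.n₁)) {u : ℕ → ℝ}
    {Lu : ℝ} {jl : ℕ} (hV : VolumeDisplays C d K R u Lu jl)
    (huθ : ∀ e ∈ (Pd.genT c).events, (Prod.fst e).kind = 0 →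
      2 ^ (d + 3) * u (Prod.fst e).step ≤ θv * p0Profile C.A₀ C.p₀ (g (Prod.fst e).step) ^ 2) :
    Δ * (Λ' ^ partnerAges (PEv.step ∘ Prod.fst) (Pd.genT c) *
          Real.exp (-credits (pcredit O C g ∘ Prod.fst) (Pd.genT c))) *
        Real.exp (∑ m ∈ Finset.range (K + 1), u m * compSum L s (fun v => (v : ℝ)) (Pd.toPGen cell c) m) ≤
      shapeTH Prod.fst C Δ Λ' R g K 0 (Pd.genT c) :=
  credit_mul_volume_le_shapeTH hslack hΔ hΛ g hL hdrop hR hn₁ hE₂ hE₃ Pd cell hS c hP hW hPK hK hV.hu hV.hLu0 hV.hj1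
    hV.hLu hV.hsmall hV.huΦ hV.huE₂ hV.huE₃ huθ

/-- **M5-2c AT PRINT's LETTER** (the live member's volume factor priced at `Λ := lamVol`): with (2.7)'s consequence, `β₀ ≥ 0`,
`cΛ ≥ 0`, the lower (2.5) envelope, the window read at `Lu := 1+β₀`, `jl := jvol d (1+β₀)`, and the member's births at
performed steps (`hsteps`), BOTH the calibration and the volume-slack display `huθ` are discharged — what remains of
M5-2c's hypotheses is the pedigree∕realisation data, the slack junction `C.a + θᵥ ≤ ½γ₀A₁²` and the constants. [folklore] -/
theorem credit_mul_volume_le_shapeTH_lamVol {O : PrintedO1s} {θv : ℝ}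
    (hslack : C.a + θv ≤ O.γ₀ * O.A₁ ^ 2 / 2) {Δ Λ' : ℝ} (hΔ : 0 ≤ Δ) (hΛ : 0 ≤ Λ') (g : ℕ → ℝ) (hL : 4 ≤ L)
    (hdrop : ∀ m, DropCtl s m) (hR : ∀ t, 1 ≤ R t) (hn₁ : 13 ≤ C.n₁) (hE₂ : 0 ≤ C.E₂) (hE₃ : 0 ≤ C.E₃)
    (Pd : Pedigree α π) (cell : π → Pt d × Finset (Pt d))
    (hS : ∀ c c', Part.old c' true ∈ Pd.parts c → Pd.step c' + 1 = Pd.step c) (c : α) {Z : Finset (Pt d)}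
    (hP : RealisesW L s R (Pd.toPGen cell c) Z) (hW : (Pd.genT c).WF (dictWT Prod.fst R C.n₁)) {K : ℕ}
    (hPK : (Pd.toPGen cell c).lastStep ≤ K) (hK : K < (Pd.genT c).reach (dictWT Prod.fst R C.n₁))
    {r κ₂ κᵥ : ℕ} {cΛ β₀ : ℝ} (hmono : ∀ m n, m < n → n ≤ K → ell g n ≤ (1 + β₀) * ell g m) (hβ₀ : 0 ≤ β₀)
    (hc : 0 ≤ cΛ) (hlow : ∀ t, t ≤ K → ell g t ^ r ≤ (R t : ℝ))
    (hWv : VolumeWindow C d K r κ₂ κᵥ cΛ θv (1 + β₀) (jvol d (1 + β₀)) g)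
    (hsteps : ∀ e ∈ (Pd.genT c).events, (Prod.fst e).kind = 0 → (Prod.fst e).step ≤ K) :
    Δ * (Λ' ^ partnerAges (PEv.step ∘ Prod.fst) (Pd.genT c) *
          Real.exp (-credits (pcredit O C g ∘ Prod.fst) (Pd.genT c))) *
        Real.exp (∑ m ∈ Finset.range (K + 1),
          Real.log (lamVol cΛ g K m) * compSum L s (fun v => (v : ℝ)) (Pd.toPGen cell c) m) ≤
      shapeTH Prod.fst C Δ Λ' R g K 0 (Pd.genT c) :=
  credit_mul_volume_le_shapeTH_of_volumeDisplays hslack hΔ hΛ g hL hdrop hR hn₁ hE₂ hE₃ Pd cell hS c hP hW hPK hK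
    (volumeDisplays_lamVol hmono hβ₀ hc hE₂ hE₃ hlow hWv)
    (huV_events_of_log_eq (log_lamVol cΛ g K) hWv Prod.fst (Pd.genT c).events hsteps)

/-- **THE BIRTHS OF A COMPONENT's TAGGED GENEALOGY ARE PERFORMED STEPS**: if the component's step is `≤ K`, every kind-`0`
event of `Pd.genT c` is dated `≤ K` (`HistoryGen.Pedigree.step_le_of_mem_events_gen` through `events_gen`) — the `hsteps`
display of `credit_mul_volume_le_shapeTH_lamVol` for a component observed at or before the cutoff. [folklore] -/
theorem births_le_of_step_le (Pd : Pedigree α π) (c : α) {K : ℕ} (hcK : Pd.step c ≤ K) :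
    ∀ e ∈ (Pd.genT c).events, (Prod.fst e).kind = 0 → (Prod.fst e).step ≤ K := fun e he _ =>
  (Pd.step_le_of_mem_events_gen c (Prod.fst e)
    (by rw [Pedigree.events_gen]; exact Finset.mem_image_of_mem _ he)).trans hcK

/-- `credit_mul_volume_le_shapeTH_lamVol` for a component whose step is `≤ K` (the `hsteps` display discharged by
`births_le_of_step_le`). [folklore] -/
theorem credit_mul_volume_le_shapeTH_lamVol_of_step_le {O : PrintedO1s} {θv : ℝ}
    (hslack : C.a + θv ≤ O.γ₀ * O.A₁ ^ 2 / 2) {Δ Λ' : ℝ} (hΔ : 0 ≤ Δ) (hΛ : 0 ≤ Λ') (g : ℕ → ℝ) (hL : 4 ≤ L)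
    (hdrop : ∀ m, DropCtl s m) (hR : ∀ t, 1 ≤ R t) (hn₁ : 13 ≤ C.n₁) (hE₂ : 0 ≤ C.E₂) (hE₃ : 0 ≤ C.E₃)
    (Pd : Pedigree α π) (cell : π → Pt d × Finset (Pt d))
    (hS : ∀ c c', Part.old c' true ∈ Pd.parts c → Pd.step c' + 1 = Pd.step c) (c : α) {Z : Finset (Pt d)}
    (hP : RealisesW L s R (Pd.toPGen cell c) Z) (hW : (Pd.genT c).WF (dictWT Prod.fst R C.n₁)) {K : ℕ}
    (hPK : (Pd.toPGen cell c).lastStep ≤ K) (hK : K < (Pd.genT c).reach (dictWT Prod.fst R C.n₁))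
    {r κ₂ κᵥ : ℕ} {cΛ β₀ : ℝ} (hmono : ∀ m n, m < n → n ≤ K → ell g n ≤ (1 + β₀) * ell g m) (hβ₀ : 0 ≤ β₀)
    (hc : 0 ≤ cΛ) (hlow : ∀ t, t ≤ K → ell g t ^ r ≤ (R t : ℝ))
    (hWv : VolumeWindow C d K r κ₂ κᵥ cΛ θv (1 + β₀) (jvol d (1 + β₀)) g) (hcK : Pd.step c ≤ K) :
    Δ * (Λ' ^ partnerAges (PEv.step ∘ Prod.fst) (Pd.genT c) *
          Real.exp (-credits (pcredit O C g ∘ Prod.fst) (Pd.genT c))) *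
        Real.exp (∑ m ∈ Finset.range (K + 1),
          Real.log (lamVol cΛ g K m) * compSum L s (fun v => (v : ℝ)) (Pd.toPGen cell c) m) ≤
      shapeTH Prod.fst C Δ Λ' R g K 0 (Pd.genT c) :=
  credit_mul_volume_le_shapeTH_lamVol hslack hΔ hΛ g hL hdrop hR hn₁ hE₂ hE₃ Pd cell hS c hP hW hPK hK hmono hβ₀ hc hlow
    hWv (births_le_of_step_le Pd c hcK)

end Junction

end

end Summit.QuantumFields.BalabanUV.T4Continuum.HistoryBankingVolumeSupply
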